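import Literature.Geometry.Lorentzian.SpacetimeLocalConvergence
import Literature.Geometry.Lorentzian.RedShiftedHorizon
import Literature.Geometry.Lorentzian.Stationary
import Literature.Geometry.Lorentzian.QuasiFinalStateDecomposition
import Literature.Geometry.Lorentzian.LeviCivitaProofs
import Summits.FinalStateConjecture.FinalStateConjecture.Statement
import HarnessLib

/-!
# Route PhotonSphereChannels · crux `ChannelsResolveTameDevelopments` — posited objects of the line
# `tame-hull-exact-rigidity-only` (route-posited definitions, D-0016 `<Route>Defs` convention)

This file carries no mathematics beyond definitions and their projection API (§1b). It is the vocabulary over which the seven registered stubs of the line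
`tame-hull-exact-rigidity-only` of crux stmt-FinalStateConjecture-10046 are stated (skeleton
`Cruxes/ChannelsResolveTameDevelopments/Lines/tame-hull-exact-rigidity-only.lean`, planner
planner-cruxplan-stmt-FinalStateConjecture-10046-tame-hull-exact-rigi-0; lead
prover-line-stmt-FinalStateConjecture-10046-0), moved verbatim out of the crux workfile so that stub
proofs can be landed as `Theorems/…` files (`--supports stmt-FinalStateConjecture-10046`) importing it:

* §0 — named sub-formulas of the route decl `PhotonSphereChannels.ChannelsResolveTameDevelopments`
  (its consequent Φ = "tame resolution"): `NoExtremalRemnant` (hypothesis (i) verbatim),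
  `outerRegion` (the `let outer` verbatim), `TameOuter` (hypothesis (ii) verbatim), the bundle
  `DevHyp`, and `IsFutureEscaping` (base points of late-time limits);
* §1 — the posited interface of the line: `farBackground`, `EndDatum` (far chart + clock of a hull
  element) with `EndDatum.B/h/hdot/doc/horizon`, `EndDatum.IsTameEnd` (eternal `(Λ, r₀)`-tame vacuum
  end with CENTRED clock-adapted tame balls — the clause that forbids truncated or boosted fake
  instances), `EndDatum.IsNonRadiating`, `EndDatum.IsSilentHorizon`, `EndDatum.IsRedShifted`,
  `EndDatum.IsColdHorizon`, `IsKerrDoc`, `IsMinkowski`, `IsHullElement`.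

Everything is a definition over EXISTING Literature declarations (`Spacetime`, `ModelBackground`,
`Kerr.region/exterior/bilin/radius/background`, `Spacetime.deviation(Extend)`, `IsLateChart`,
`supCkENorm`, `Spacetime.docOfEnd`, `Spacetime.futureEventHorizonOfEnd`,
`LorentzianMetric.HasSurfaceGravityGe`, `Spacetime.SubconvergesLocallyTo`, `VacuumCauchyDevelopment`,
`Summit.FinalStateConjecture.HasCompleteNullInfinity`); nothing here restates a route item (the
stubs themselves stay in the crux workfile until proved). Design notes are in the individual
docstrings (copied from the planner's skeleton). This module deliberately does NOT import the route
file `Theses.PhotonSphereChannels` (closing modules must stay importable by it).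
-/

noncomputable section

-- the operator-norm instance on `E4 →L[ℝ] E4 →L[ℝ] ℝ` needs one more level of pending
-- instance problems than the default (as in `BoundedGeometry.lean`)
set_option maxSynthPendingDepth 3
-- every `Summit.FinalStateConjecture.FinalStateConjecture.…` name repeats the summit = sub-problem segment (D-0017 layout)
set_option linter.dupNamespace false

open Set Filter Function TopologicalSpace Manifold Bundle
open scoped Topology Manifold ContDiff ENNReal NNReal

namespace Summit.FinalStateConjecture.FinalStateConjecture.Theorems.TameHull

open Literature.Geometry.Lorentzian

/-! ### §0 The crux, cut into named pieces (verbatim sub-formulas of the route decl) -/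

section Development

variable {X : Type} [TopologicalSpace X] [ChartedSpace E3 X] [IsManifold (𝓡 3) ∞ X]
  [T2Space X] [SecondCountableTopology X] [ConnectedSpace X] {D : InitialDataSet (𝓡 3) X}

/-- Hypothesis (i) of Φ, verbatim: NO EXTREMAL REMNANT — no late-time chart from a boosted extremal
Kerr exterior along which the `C²` deviation tends to `0` on every near-zone slab. [folklore] -/
def NoExtremalRemnant (𝒟 : VacuumCauchyDevelopment D) : Prop :=
  ∀ (Λ : lorentzGroup) (c : E4) (M a : ℝ), Kerr.IsExtremal M a →
    ¬ ∃ (τ₀ : ℝ) (Ψ : (boostedKerrBackground Λ c M a).domain → 𝒟.carrier),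
      𝒟.toSpacetime.IsLateChart (boostedKerrBackground Λ c M a) Set.univ τ₀ Ψ ∧
        ∀ R : ℝ, Tendsto (fun τ => 𝒟.toSpacetime.truncDeviationCk
          (boostedKerrBackground Λ c M a) Ψ 2 R τ) atTop (𝓝 0)

/-- The OUTER REGION of Φ, verbatim the `let outer` of the route decl:
`J⁺(ι X) ∩ ⋃ I⁻(future branch of a future-complete normalised null ray from ι X)`. [folklore] -/
def outerRegion (𝒟 : VacuumCauchyDevelopment D) [𝒟.metric.HasLeviCivita] : Set 𝒟.carrier :=
  𝒟.metric.causalFuture 𝒟.timeOrientation (Set.range 𝒟.embed) ∩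
    {q | ∃ (p : X) (γ : ℝ → 𝒟.carrier) (dom : Set ℝ),
      𝒟.metric.IsNormalisedNullRayFrom 𝒟.timeOrientation 𝒟.embed 𝒟.normal p γ dom ∧
        ¬ BddAbove dom ∧
          q ∈ 𝒟.metric.chronologicalPast 𝒟.timeOrientation (γ '' (dom ∩ Set.Ici 0))}

/-- Hypothesis (ii) of Φ, verbatim: the outer region is `(r₀, Λ)`-TAME — every point is the centre
of a smooth open-embedded coordinate ball of radius `r₀` with `sup_{C³} ‖Ψ^*g − η‖ ≤ Λ` and
`sup_{C⁰} ‖Ψ^*g − η‖ ≤ 1/2`. [cite: Anderson2004, Def. 1.1 and §5] -/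
def TameOuter (𝒟 : VacuumCauchyDevelopment D) : Prop :=
  ∀ [𝒟.metric.HasLeviCivita], ∃ r₀ : ℝ, 0 < r₀ ∧ ∃ Λ : ℝ≥0, ∀ q ∈ outerRegion 𝒟,
    let U : Opens E4 := ⟨Metric.ball (0 : E4) r₀, Metric.isOpen_ball⟩
    ∃ Ψ : U → 𝒟.carrier, 𝒟.toSpacetime.IsLateChart (Minkowski.backgroundOn U) Set.univ (-r₀) Ψ ∧
      (∃ x : U, (x : E4) = 0 ∧ Ψ x = q) ∧
      supCkENorm (U : Set E4) 3 (𝒟.toSpacetime.deviationExtend (Minkowski.backgroundOn U) Ψ) ≤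
          (Λ : ℝ≥0∞) ∧
        supCkENorm (U : Set E4) 0 (𝒟.toSpacetime.deviationExtend (Minkowski.backgroundOn U) Ψ) ≤
          1 / 2

/-- The standing hypotheses of Φ on ONE development (each stub's docstring says which it uses):
MGHD, complete `𝓘⁺`, (i), (ii). [folklore] -/
structure DevHyp (𝒟 : VacuumCauchyDevelopment D) : Prop where
  /-- `𝒟` is a maximal globally hyperbolic vacuum development. -/
  maximal : 𝒟.IsMaximal
  /-- Complete future null infinity (Christodoulou, sojourn form). -/
  scri : Summit.FinalStateConjecture.HasCompleteNullInfinity 𝒟.toCauchyDevelopment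
  /-- (i) no extremal remnant. -/
  noRemnant : NoExtremalRemnant 𝒟
  /-- (ii) tame outer region. -/
  tame : TameOuter 𝒟

/-- A sequence of outer points is FUTURE-ESCAPING if it eventually leaves the causal past of every
compact set (the base points of hull elements). [folklore] -/
def IsFutureEscaping (𝒟 : VacuumCauchyDevelopment D) [𝒟.metric.HasLeviCivita]
    (q : ℕ → 𝒟.carrier) : Prop :=
  (∀ n, q n ∈ outerRegion 𝒟) ∧
    ∀ K : Set 𝒟.carrier, IsCompact K →
      ∀ᶠ n in atTop, q n ∉ 𝒟.metric.causalPast 𝒟.timeOrientation K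

end Development

/-! ### §1 The posited interface: eternal tame ends, silence, red-shift / cold, Kerr d.o.c. -/

/-- The Schwarzschild far background on the full cylinder `ℝ × {r > R}` (ingoing Kerr–Schild form
`g_{M,0}`, time `x⁰`, radius `r`) — the `B` of route EternalPapapetrou's far-chart items. [folklore] -/
def farBackground (M R : ℝ) : ModelBackground :=
  ⟨Kerr.region 0 R, Kerr.bilin M 0, fun x ↦ x 0, Kerr.radius 0⟩

/-- **End datum** of a spacetime `𝓢` (posited data of a hull element): a reference mass `M` and
inner radius `R` of the far cylinder, a bound `C`, an ETERNAL FAR CHART `far : {r > R} → 𝓢` defined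
for all `x⁰ ∈ ℝ`, and a CLOCK `clock : 𝓢 → ℝ` (the temporal function of sub-bet α). Constraints
live in `IsTameEnd`. [folklore] -/
structure EndDatum (𝓢 : Spacetime.{0} 4) where
  /-- Reference (Schwarzschild) mass of the far background. -/
  M : ℝ
  /-- Inner radius of the far cylinder. -/
  R : ℝ
  /-- The `r`-weighted `C³` bound of the far deviation. -/
  C : ℝ
  /-- The eternal far chart on `Kerr.region 0 R = ℝ × {r > max R 0}`. -/
  far : Kerr.region (0 : ℝ) R → 𝓢.carrier
  /-- The clock (temporal function), equal to `x⁰` on the far chart. -/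
  clock : 𝓢.carrier → ℝ

namespace EndDatum

variable {𝓢 : Spacetime.{0} 4}

/-- The far background of the datum. [folklore] -/
def B (E : EndDatum 𝓢) : ModelBackground := farBackground E.M E.R

/-- The far deviation `h = far^* g − g_{M,0}`, extended by zero off the cylinder. [folklore] -/
def h (E : EndDatum 𝓢) : E4 → E4 →L[ℝ] E4 →L[ℝ] ℝ := 𝓢.deviationExtend E.B E.far

/-- `∂₀ h`, the chart-time derivative of the far deviation (the order-`1/r` radiation field lives
in `r · ∂₀ h`). [folklore] -/
def hdot (E : EndDatum 𝓢) : E4 → E4 →L[ℝ] E4 →L[ℝ] ℝ := fun y ↦ fderiv ℝ E.h y (E4.basisVector 0)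

/-- The domain of outer communications of the end, `I⁺(far) ∩ I⁻(far)`. [cite: Wald1984, §12.1] -/
def doc (E : EndDatum 𝓢) : Set 𝓢.carrier := 𝓢.docOfEnd (Set.range E.far)

/-- The future event horizon of the end, `∂I⁻(far) ∩ I⁺(far)` (possibly empty). [cite: Wald1984, §12.1] -/
def horizon (E : EndDatum 𝓢) : Set 𝓢.carrier := 𝓢.futureEventHorizonOfEnd (Set.range E.far)

/-- **Eternal `(Λ, r₀)`-tame end** (posited interface; A constructs instances, C/D/Q consume them).
Clauses: `0 < r₀`; `0 ≤ M`, `max (2M) 0 < R`; VACUUM; the far chart is an injective `C^∞` local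
diffeomorphism of the whole cylinder with `‖D^m h‖ · r ≤ C` for `m ≤ 3` (uniform in `x⁰ ∈ ℝ`:
eternal, asymptotically flat, no derivative gain) whose `∂₀` is future-directed; the clock is
smooth and equals `x⁰` on the far chart; and every point of the domain of outer communications is
the CENTRE of a CLOCK-ADAPTED tame ball: a late chart of `Metric.ball 0 r₀` (Minkowski background)
with `C³`-deviation `≤ Λ`, `C⁰`-deviation `≤ 1/2`, future-directed `∂₀`, and `clock ∘ Ψ = x⁰ +
clock q` (the clock is the coordinate time of the ball — this ties every later use of the clock,
in particular surface gravity, to the tame frames; cf. RedShiftedHorizon.lean, module docstring,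
and TRIAGE r1-1 (b)). The centred balls force `𝓢` to contain a uniform collar of its d.o.c.
(across the horizon) and forbid artificial truncations. [cite: Anderson2004, Def. 1.1 and Thm 5.1] -/
structure IsTameEnd (E : EndDatum 𝓢) (Λ : ℝ≥0) (r₀ : ℝ) : Prop where
  /-- The ball radius is positive. -/
  r₀_pos : 0 < r₀
  /-- The reference mass is nonnegative. -/
  mass_nonneg : 0 ≤ E.M
  /-- The far cylinder lies outside `r = 2M`. -/
  lt_R : max (2 * E.M) 0 < E.R
  /-- Vacuum: `Ric(g) = 0`. -/
  vacuum : ∀ [𝓢.metric.HasLeviCivita], 𝓢.metric.toPseudoRiemannianMetric.IsRicciFlat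
  /-- The far chart is a `C^∞` local diffeomorphism of the cylinder … -/
  far_isLocalDiffeomorph : IsLocalDiffeomorph 𝓘(ℝ, E4) (𝓡 4) ∞ E.far
  /-- … and injective. -/
  far_injective : Function.Injective E.far
  /-- `‖D^m h‖ · r ≤ C` on the whole cylinder for `m ≤ 3`. -/
  far_bound : ∀ m ≤ 3, ∀ x : Kerr.region (0 : ℝ) E.R,
    ‖iteratedFDeriv ℝ m E.h x.1‖ * Kerr.radius 0 x.1 ≤ E.C
  /-- The far chart's `∂₀` points to the future. -/
  far_future : ∀ x : Kerr.region (0 : ℝ) E.R,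
    𝓢.timeOrientation.IsFutureDirected (mfderiv 𝓘(ℝ, E4) (𝓡 4) E.far x (E4.basisVector 0))
  /-- The clock is smooth … -/
  clock_smooth : ContMDiff (𝓡 4) 𝓘(ℝ, ℝ) ∞ E.clock
  /-- … and equals `x⁰` on the far chart. -/
  clock_far : ∀ x : Kerr.region (0 : ℝ) E.R, E.clock (E.far x) = x.1 0
  /-- Clock-adapted centred tame balls at every point of the d.o.c. -/
  tame : ∀ q ∈ E.doc,
    let U : Opens E4 := ⟨Metric.ball (0 : E4) r₀, Metric.isOpen_ball⟩
    ∃ Ψ : U → 𝓢.carrier, 𝓢.IsLateChart (Minkowski.backgroundOn U) Set.univ (-r₀) Ψ ∧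
      (∃ x : U, (x : E4) = 0 ∧ Ψ x = q) ∧
      supCkENorm (U : Set E4) 3 (𝓢.deviationExtend (Minkowski.backgroundOn U) Ψ) ≤ (Λ : ℝ≥0∞) ∧
      supCkENorm (U : Set E4) 0 (𝓢.deviationExtend (Minkowski.backgroundOn U) Ψ) ≤ 1 / 2 ∧
      (∀ x : U, 𝓢.timeOrientation.IsFutureDirected
        (mfderiv 𝓘(ℝ, E4) (𝓡 4) Ψ x (E4.basisVector 0))) ∧
      ∀ x : U, E.clock (Ψ x) = (x : E4) 0 + E.clock q

/-- **Two-sided non-radiating at order `1/r`** (silence at `𝓘⁺` AND `𝓘⁻`, chart form, as in route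
EternalPapapetrou's `FarZoneEternalPapapetrou`): `r · ‖D^m ∂₀ h‖ → 0` as `r → ∞`, uniformly in
`x⁰ ∈ ℝ`, for `m ≤ 2` — no news out, none in, for all times. [cite: AlexakisSchlue2018, Thm. 1.1] -/
def IsNonRadiating (E : EndDatum 𝓢) : Prop :=
  ∀ m ≤ 2, ∀ δ > (0 : ℝ), ∃ R' : ℝ, ∀ x : Kerr.region (0 : ℝ) E.R,
    R' < Kerr.radius 0 x.1 → ‖iteratedFDeriv ℝ m E.hdot x.1‖ * Kerr.radius 0 x.1 ≤ δ

/-- **Silent horizon**: the event horizon of the end carries a future null generator field `L`,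
`C^∞` near the horizon, normalised by the clock (`d clock (L) = 1`), tangent (the horizon is forward
invariant under the flow of `L`, as in `HasSurfaceGravityGe`), along which the horizon is
NON-EXPANDING AND SHEAR-FREE: `g(∇_v L, w) = 0` for all `v, w ⊥ L` (null second fundamental form
`χ_L = 0`; by Raychaudhuri in vacuum, `θ ≡ 0` alone forces this). Vacuous for an empty horizon. [cite: Wald1984, §12.5] -/
def IsSilentHorizon (E : EndDatum 𝓢) : Prop :=
  ∀ [𝓢.metric.HasLeviCivita], ∃ L : Π x : 𝓢.carrier, TangentSpace (𝓡 4) x,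
    (∃ 𝒩 : Set 𝓢.carrier, IsOpen 𝒩 ∧ E.horizon ⊆ 𝒩 ∧
      ContMDiffOn (𝓡 4) (𝓡 4).tangent ∞
        (fun x : 𝓢.carrier ↦ (TotalSpace.mk' E4 x (L x) : TangentBundle (𝓡 4) 𝓢.carrier)) 𝒩) ∧
    (∀ p ∈ E.horizon, 𝓢.metric.IsNull (L p) ∧ 𝓢.timeOrientation.IsFutureDirected (L p) ∧
      mvfderiv (𝓡 4) E.clock p (L p) = 1 ∧
      ∀ v w : TangentSpace (𝓡 4) p, 𝓢.metric.val p (L p) v = 0 → 𝓢.metric.val p (L p) w = 0 →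
        𝓢.metric.val p (𝓢.metric.leviCivita L p v) w = 0) ∧
    ∀ (γ : ℝ → 𝓢.carrier) (a b : ℝ), a ≤ b → IsMIntegralCurveOn γ L (Icc a b) →
      γ a ∈ E.horizon → γ b ∈ E.horizon

/-- **Uniformly red-shifted horizon** with respect to the datum's clock: surface gravity `≥ κ₀` on
the whole (eternal) horizon (`LorentzianMetric.HasSurfaceGravityGe`, Dafermos–Rodnianski Thm 7.1
hypothesis). Meaningful because the clock is tied to the tame frames (`IsTameEnd.tame`). [cite: DafermosRodnianski2008, §7.1 Thm. 7.1] -/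
def IsRedShifted (E : EndDatum 𝓢) (κ₀ : ℝ) : Prop :=
  ∀ [𝓢.metric.HasLeviCivita],
    𝓢.metric.HasSurfaceGravityGe 𝓢.timeOrientation E.horizon E.clock κ₀

/-- **Cold horizon** (clock-invariant form of `κ = 0`): the horizon is NONEMPTY and carries an
AFFINELY parametrised future null generator field (`∇_L L = 0`) whose clock rate `d clock (L)` is
bounded above and below by positive constants along the whole horizon (affine parameter and adapted
clock comparable — impossible on a non-degenerate horizon, where the affine parameter is exponential
in the clock). [cite: DafermosRodnianski2008, §3.3.2 Prop. 3.3.1] -/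
def IsColdHorizon (E : EndDatum 𝓢) : Prop :=
  E.horizon.Nonempty ∧ ∀ [𝓢.metric.HasLeviCivita],
    ∃ (L : Π x : 𝓢.carrier, TangentSpace (𝓡 4) x) (c : ℝ), 0 < c ∧
      (∃ 𝒩 : Set 𝓢.carrier, IsOpen 𝒩 ∧ E.horizon ⊆ 𝒩 ∧
      ContMDiffOn (𝓡 4) (𝓡 4).tangent ∞
        (fun x : 𝓢.carrier ↦ (TotalSpace.mk' E4 x (L x) : TangentBundle (𝓡 4) 𝓢.carrier)) 𝒩) ∧
      (∀ p ∈ E.horizon, 𝓢.metric.IsNull (L p) ∧ 𝓢.timeOrientation.IsFutureDirected (L p) ∧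
        𝓢.metric.leviCivita L p (L p) = 0 ∧
        c⁻¹ ≤ mvfderiv (𝓡 4) E.clock p (L p) ∧ mvfderiv (𝓡 4) E.clock p (L p) ≤ c) ∧
      ∀ (γ : ℝ → 𝓢.carrier) (a b : ℝ), a ≤ b → IsMIntegralCurveOn γ L (Icc a b) →
        γ a ∈ E.horizon → γ b ∈ E.horizon

end EndDatum

/-- **The region `O ⊆ 𝓢` is a Kerr exterior `(M, a)`**: an injective smooth map of
`Kerr.exterior M a = {r > r₊}` (ingoing Kerr–Schild chart) onto `O` pulling `g` back EXACTLY to the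
Kerr–Schild form, `Ψ^* g − g_{M,a} = 0` (`Spacetime.deviation` for `Kerr.background M a`),
time-oriented (`Ψ_* ∂_{t*}` future-directed where `r > 2M`, i.e. outside the ergoregion): the
black-hole, not the white-hole, exterior. [cite: DafermosLuk2017, Conjecture 1] -/
def IsKerrDoc (𝓢 : Spacetime.{0} 4) (O : Set 𝓢.carrier) (M a : ℝ) : Prop :=
  ∃ Ψ : Kerr.exterior M a → 𝓢.carrier, Function.Injective Ψ ∧ ContMDiff 𝓘(ℝ, E4) (𝓡 4) ∞ Ψ ∧
    Set.range Ψ = O ∧ (∀ x, 𝓢.deviation (Kerr.background M a) Ψ x = 0) ∧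
      ∀ x : Kerr.exterior M a, 2 * M < Kerr.radius a x.1 →
        𝓢.timeOrientation.IsFutureDirected (mfderiv 𝓘(ℝ, E4) (𝓡 4) Ψ x (E4.basisVector 0))

/-- **`𝓢` is Minkowski space**: a smooth bijection `E4 → 𝓢` pulling `g` back exactly to `η`
(`Spacetime.minkowskiDeviation Ψ = 0`), time-oriented. [cite: ChristodoulouKlainerman1993, Thm. 1.0.2] -/
def IsMinkowski (𝓢 : Spacetime.{0} 4) : Prop :=
  ∃ Ψ : E4 → 𝓢.carrier, Function.Bijective Ψ ∧ ContMDiff 𝓘(ℝ, E4) (𝓡 4) ∞ Ψ ∧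
    (∀ x, 𝓢.minkowskiDeviation Ψ x = 0) ∧
      ∀ x, 𝓢.timeOrientation.IsFutureDirected (mfderiv 𝓘(ℝ, E4) (𝓡 4) Ψ x (E4.basisVector 0))

section Hull

variable {X : Type} [TopologicalSpace X] [ChartedSpace E3 X] [IsManifold (𝓡 3) ∞ X]
  [T2Space X] [SecondCountableTopology X] [ConnectedSpace X] {D : InitialDataSet (𝓡 3) X}

/-- **Hull element** of the development `𝒟` in the tameness class `(Λ, r₀)`: a future-escaping
sequence of OUTER points `q`, a `(Λ, r₀)`-tame end `(𝓢, E)` and a base point `p` such that the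
pointed spacetimes `(𝒟, qₙ)` subconverge locally in `C²` (Cheeger–Gromov;
`Spacetime.SubconvergesLocallyTo`, no covering clause — the centred balls of `IsTameEnd` pin what
the limit must contain) to `(𝓢, p)`. The HULL is the class of all hull elements. [cite: Anderson2004, Def. 1.1] -/
def IsHullElement (𝒟 : VacuumCauchyDevelopment D) [𝒟.metric.HasLeviCivita] (Λ : ℝ≥0) (r₀ : ℝ)
    (q : ℕ → 𝒟.carrier) (𝓢 : Spacetime.{0} 4) (E : EndDatum 𝓢) (p : 𝓢.carrier) : Prop :=
  IsFutureEscaping 𝒟 q ∧ E.IsTameEnd Λ r₀ ∧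
    Spacetime.SubconvergesLocallyTo (fun _ ↦ 𝒟.toSpacetime) q 𝓢 p 2

end Hull


/-! ### §1b Basic API of the posited objects (used by every stub file) -/

section API

variable {X : Type} [TopologicalSpace X] [ChartedSpace E3 X] [IsManifold (𝓡 3) ∞ X]
  [ConnectedSpace X] {D : InitialDataSet (𝓡 3) X}

/-- `DevHyp 𝒟` is, clause by clause, the hypothesis block of the consequent Φ of the crux:
maximality, complete `𝓘⁺`, (i) no extremal remnant, (ii) tame outer region (registered sub-goal
`devHyp_iff` of stmt-FinalStateConjecture-10046: the API lemma that lets stub files trade the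
bundle for the crux's own hypotheses). [folklore] -/
theorem devHyp_iff : ∀ {X : Type} [TopologicalSpace X] [ChartedSpace E3 X] [IsManifold (𝓡 3) ∞ X] [ConnectedSpace X] {D : InitialDataSet (𝓡 3) X} (𝒟 : VacuumCauchyDevelopment D), DevHyp 𝒟 ↔ (𝒟.IsMaximal ∧ Summit.FinalStateConjecture.HasCompleteNullInfinity 𝒟.toCauchyDevelopment ∧ NoExtremalRemnant 𝒟 ∧ TameOuter 𝒟) :=
  fun _ ↦ ⟨fun h ↦ ⟨h.maximal, h.scri, h.noRemnant, h.tame⟩, fun h ↦ ⟨h.1, h.2.1, h.2.2.1, h.2.2.2⟩⟩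

/-- A hull element's end datum is a tame end (projection). [folklore] -/
theorem IsHullElement.isTameEnd {𝒟 : VacuumCauchyDevelopment D} [𝒟.metric.HasLeviCivita]
    {Λ : ℝ≥0} {r₀ : ℝ} {q : ℕ → 𝒟.carrier} {𝓢 : Spacetime.{0} 4} {E : EndDatum 𝓢} {p : 𝓢.carrier}
    (h : IsHullElement 𝒟 Λ r₀ q 𝓢 E p) : E.IsTameEnd Λ r₀ :=
  h.2.1

/-- A hull element's base sequence is future-escaping (projection). [folklore] -/
theorem IsHullElement.isFutureEscaping {𝒟 : VacuumCauchyDevelopment D} [𝒟.metric.HasLeviCivita]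
    {Λ : ℝ≥0} {r₀ : ℝ} {q : ℕ → 𝒟.carrier} {𝓢 : Spacetime.{0} 4} {E : EndDatum 𝓢} {p : 𝓢.carrier}
    (h : IsHullElement 𝒟 Λ r₀ q 𝓢 E p) : IsFutureEscaping 𝒟 q :=
  h.1

/-- A hull element's pointed spacetimes subconverge locally in `C²` to the limit (projection).
[folklore] -/
theorem IsHullElement.subconverges {𝒟 : VacuumCauchyDevelopment D} [𝒟.metric.HasLeviCivita]
    {Λ : ℝ≥0} {r₀ : ℝ} {q : ℕ → 𝒟.carrier} {𝓢 : Spacetime.{0} 4} {E : EndDatum 𝓢} {p : 𝓢.carrier}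
    (h : IsHullElement 𝒟 Λ r₀ q 𝓢 E p) :
    Spacetime.SubconvergesLocallyTo (fun _ ↦ 𝒟.toSpacetime) q 𝓢 p 2 :=
  h.2.2

end API

end Summit.FinalStateConjecture.FinalStateConjecture.Theorems.TameHull

end
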